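import Literature.NumberTheory.LFunctions.RayClassLSeriesLogDerivLeft
import Literature.NumberTheory.LFunctions.RayClassLSeriesWindows
import Literature.NumberTheory.LFunctions.ClassGroupExplicitFormula
import HarnessLib

/-!
# The smoothed explicit formula for Hecke `L`-series of primitive ray class characters

Topic `Literature/NumberTheory/LFunctions`; namespace `Literature.NumberTheory.LFunctions`.  The ray-class
analogue (conductor `𝔣 = 𝔪`) of `ClassGroupExplicitFormula.lean`; everything here is PROVED, the definitions
(`rcCoef`, `rcEFIntegrand`, `rcEFRemainder`) are glue.

For a number field `K` (degree `n`), a modulus `𝔪 ≠ 0`, a primitive ray class character `χ mod 𝔪` of sign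
type `p`, non-principal on the ideals prime to `𝔪`, entire continuations `L`, `L̄` of `L(χ, ·)`, `L(χ̄, ·)`,
an admissible smoothing `f` (`IsSmoothedEFTest f p₀ p' p'' x₀`) with `f(0) = 0`, and `−1/2 < Re s < 3/2`,
`s` not a non-trivial zero of `L`:

  `Σ_n Λ_χ(n) f(log n) n^{−s} = − Σ_ρ m(ρ) F(s − ρ) − m₀ F(s) + (1/2π) ∫_ℝ (−L'/L)(−1/2 + iy) F(s + 1/2 − iy) dy`

(`rcCoefFordK_eq_explicit`), `Λ_χ(n) = Σ_{𝔑𝔫 = n} χ(𝔫)Λ_K(𝔫)`, `ρ` over the non-trivial zeros of `L`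
(`0 < β < 1`, absolutely convergent: `summable_norm_rcZeroTerm`), `m₀ = ord₀ L` (the only possible zero of `L`
in `−1/2 ≤ Re s ≤ 0` is `s = 0`: `zero_continuation_cases`).  This is the exact form of Lagarias–Odlyzko §7 /
Thorner–Zaman Lemma 4.3 for a single Hecke character.  Inputs: the residue theorem
(`EntireEF.rectBoundaryIntegral_neg_logDeriv_mul_eq`), good heights and window counts
(`RayClassLSeriesWindows`), `L'/L` on the strip at good heights (`RayClassLSeriesStripBounds`), on
`Re s = −1/2` (`RayClassLSeriesLogDerivLeft`) and on `Re s > 1` (`RayClassLSeriesDirichlet`), and the prime side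
for a general coefficient sequence (`NumberField.integral_LSeries_coef_mul_fordLaplace₀`).

## References

* J. C. Lagarias, A. M. Odlyzko, in *Algebraic Number Fields* (1977), §7 (7.2)–(7.4). [LagariasOdlyzko1977]
* J. Thorner, A. Zaman, ANT 13 (2019), Lemma 4.3. [ThornerZaman2019]
* D. R. Heath-Brown, PLMS 64 (1992), Lemma 5.1. [HeathBrown1992PLMS]
-/

noncomputable section

open Complex Real MeasureTheory Set Filter Topology ArithmeticFunction NumberField NumberField.InfinitePlace
  IsDedekindDomain
open scoped NumberField nonZeroDivisors
open scoped Classical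

namespace Literature.NumberTheory.LFunctions

open Literature.NumberTheory.LFunctions.EntireEF Literature.NumberTheory.LFunctions.LogFreeDensity
  Literature.NumberTheory.LFunctions.LogFreeLocal Literature.Analysis.Complex

variable {K : Type} [Field K] [NumberField K]
variable {𝔪 : Ideal (𝓞 K)} {ψ : HeightOneSpectrum (𝓞 K) → ℂ} {p : Finset {w : InfinitePlace K // IsReal w}}

/-! ## The coefficients `Λ_χ`, the integrand, the remainder -/

/-- `Λ_χ(n) = Σ_{𝔑𝔫 = n} χ(𝔫) Λ_K(𝔫)` as a function on `ℕ`. [cite: LagariasOdlyzko1977, §5 (5.2)] -/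
abbrev rcCoef (𝔪 : Ideal (𝓞 K)) (ψ : HeightOneSpectrum (𝓞 K) → ℂ) : ℕ → ℂ :=
  NumberField.twistVonMangoldt K (rayClassCoeffHom 𝔪 ψ)

/-- `‖Λ_χ(n)‖ ≤ n_K Λ(n)`. [cite: LagariasOdlyzko1977, §5 (5.3)] -/
theorem norm_rcCoef_le (h𝔪 : 𝔪 ≠ ⊥) (hψ : IsRayClassCharacter 𝔪 ψ) (n : ℕ) :
    ‖rcCoef 𝔪 ψ n‖ ≤ Module.finrank ℚ K * Λ n :=
  (NumberField.norm_twistVonMangoldt_le (norm_rayClassCoeffHom_le h𝔪 fun v hv ↦ (hψ.norm_eq_one v hv).le) n).trans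
    (NumberField.vonMangoldtNorm_le_finrank_mul n)

omit [NumberField K] in
/-- The integrand `G(w) = (−L'/L)(w) · F(s − w)` of an entire `L`. [folklore] -/
def rcEFIntegrand (L : ℂ → ℂ) (f : ℝ → ℝ) (s w : ℂ) : ℂ :=
  -logDeriv L w * fordLaplace₀ f (s - w)

omit [NumberField K] in
/-- The left-line integral `J(s) = (1/2π) ∫_ℝ G(−1/2 + iy) dy`. [folklore] -/
def rcEFRemainder (L : ℂ → ℂ) (f : ℝ → ℝ) (s : ℂ) : ℂ :=
  (1 / (2 * π) : ℂ) * ∫ y : ℝ, rcEFIntegrand L f s (((-(1 / 2) : ℝ) : ℂ) + y * I)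

/-! ## `L ≠ 0` on `Re s ≥ 1`; the zeros with `−1/2 ≤ Re w ≤ 3/2` -/

/-- `L(s) ≠ 0` for `Re s ≥ 1` (Euler product and Hecke–Landau). [folklore] -/
private theorem continuation_ne_zero_of_one_le_re' (h𝔪 : 𝔪 ≠ ⊥) (hψ : IsRayClassCharacter 𝔪 ψ)
    (hnt : ∃ v : HeightOneSpectrum (𝓞 K), ¬ 𝔪 ≤ v.asIdeal ∧ ψ v ≠ 1)
    {L : ℂ → ℂ} (hL : Differentiable ℂ L) (hLs : ∀ s : ℂ, 1 < s.re → L s = rayClassLSeries 𝔪 ψ s)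
    {s : ℂ} (hs : 1 ≤ s.re) : L s ≠ 0 := by
  rcases hs.lt_or_eq with hlt | heq
  · have h := exp_neg_finrank_div_le_norm_rayClassLSeries h𝔪 (fun v hv ↦ (hψ.norm_eq_one v hv).le) hlt
    intro h0
    rw [← hLs _ hlt, h0, norm_zero] at h
    exact absurd h (not_le.mpr (Real.exp_pos _))
  · exact rayClassLSeries_entire_apply_ne_zero_of_re_eq_one h𝔪 hψ hnt hL hLs heq.symm

/-- `L(2 + it) ≠ 0`. [folklore] -/
private theorem continuation_two_ne_zero (h𝔪 : 𝔪 ≠ ⊥) (hψ : IsRayClassCharacter 𝔪 ψ)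
    (hnt : ∃ v : HeightOneSpectrum (𝓞 K), ¬ 𝔪 ≤ v.asIdeal ∧ ψ v ≠ 1)
    {L : ℂ → ℂ} (hL : Differentiable ℂ L) (hLs : ∀ s : ℂ, 1 < s.re → L s = rayClassLSeries 𝔪 ψ s) (t : ℝ) :
    L (2 + (t : ℂ) * I) ≠ 0 :=
  continuation_ne_zero_of_one_le_re' h𝔪 hψ hnt hL hLs (by simp)

omit [NumberField K] in
/-- The character `χ̄` is also non-principal on the ideals prime to `𝔪`. [folklore] -/
private theorem star_nontrivial'' (hnt : ∃ v : HeightOneSpectrum (𝓞 K), ¬ 𝔪 ≤ v.asIdeal ∧ ψ v ≠ 1) :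
    ∃ v : HeightOneSpectrum (𝓞 K), ¬ 𝔪 ≤ v.asIdeal ∧ star ψ v ≠ 1 := by
  obtain ⟨v, hv, hv1⟩ := hnt
  refine ⟨v, hv, fun h ↦ hv1 ?_⟩
  have := congrArg star h
  simpa using this

/-- **The zeros of `L` with `−1/2 ≤ Re w ≤ 3/2`**: either non-trivial (`0 < Re w < 1`) or the integer `w = 0`
(reflection + non-vanishing on `Re ≥ 1`). [cite: LagariasOdlyzko1977, §5 (5.8)–(5.9)] -/
theorem zero_continuation_cases (hψ : IsRayClassCharacter 𝔪 ψ) (hprim : IsPrimitive 𝔪 ψ)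
    (hp : IsSignType 𝔪 ψ p) (h𝔪 : 𝔪 ≠ ⊥)
    (hnt : ∃ v : HeightOneSpectrum (𝓞 K), ¬ 𝔪 ≤ v.asIdeal ∧ ψ v ≠ 1)
    {L L' : ℂ → ℂ} (hL : Differentiable ℂ L) (hLs : ∀ s : ℂ, 1 < s.re → L s = rayClassLSeries 𝔪 ψ s)
    (hL' : Differentiable ℂ L') (hL's : ∀ s : ℂ, 1 < s.re → L' s = rayClassLSeries 𝔪 (star ψ) s)
    {w : ℂ} (h0 : L w = 0) (hre1 : -(1 / 2) ≤ w.re) (hre2 : w.re ≤ 3 / 2) :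
    (0 < w.re ∧ w.re < 1) ∨ w = 0 := by
  by_cases hZ : ∃ n : ℤ, w = n
  · obtain ⟨n, rfl⟩ := hZ
    right
    have h1 : (n : ℂ).re = n := by simp
    rw [h1] at hre1 hre2
    have hn0 : -1 < n := by
      have : (-1 : ℝ) < n := by linarith
      exact_mod_cast this
    have hn1 : n < 2 := by
      have : (n : ℝ) < 2 := by linarith
      exact_mod_cast this
    interval_cases n
    · simp
    · exfalso; exact continuation_ne_zero_of_one_le_re' h𝔪 hψ hnt hL hLs (by simp) h0
  · push Not at hZ
    left
    have hwZ : ∀ n : ℤ, w ≠ n := fun n h ↦ hZ n h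
    have hlt1 : w.re < 1 := by
      by_contra hge; rw [not_lt] at hge
      exact continuation_ne_zero_of_one_le_re' h𝔪 hψ hnt hL hLs hge h0
    refine ⟨?_, hlt1⟩
    by_contra hle; rw [not_lt] at hle
    -- `Re w ≤ 0`: reflect
    have hL'w : L' (1 - w) ≠ 0 :=
      continuation_ne_zero_of_one_le_re' h𝔪 hψ.star (star_nontrivial'' hnt) hL' hL's (by simp; linarith)
    exact (logDeriv_continuation_reflect hψ hprim hp h𝔪 hL hLs hL' hL's hwZ hL'w).1 h0

/-- At a height `T` avoided by the ordinates of the non-trivial zeros, no zero of `L` lies on the boundary of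
`[−1/2, 3/2] × [−T, T]` (`T > 0`). [folklore] -/
private theorem rect_boundary_free' (hψ : IsRayClassCharacter 𝔪 ψ) (hprim : IsPrimitive 𝔪 ψ)
    (hp : IsSignType 𝔪 ψ p) (h𝔪 : 𝔪 ≠ ⊥)
    (hnt : ∃ v : HeightOneSpectrum (𝓞 K), ¬ 𝔪 ≤ v.asIdeal ∧ ψ v ≠ 1)
    {L L' : ℂ → ℂ} (hL : Differentiable ℂ L) (hLs : ∀ s : ℂ, 1 < s.re → L s = rayClassLSeries 𝔪 ψ s)
    (hL' : Differentiable ℂ L') (hL's : ∀ s : ℂ, 1 < s.re → L' s = rayClassLSeries 𝔪 (star ψ) s)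
    {T : ℝ} (hT : 0 < T)
    (hgood : ∀ ρ : ℂ, L ρ = 0 → 0 < ρ.re → ρ.re < 1 → ρ.im ≠ T ∧ ρ.im ≠ -T) :
    ∀ ρ : ℂ, L ρ = 0 → ρ.re ∈ Icc (-(1 / 2) : ℝ) (3 / 2) → ρ.im ∈ Icc (-T) T →
      ρ.re ∈ Ioo (-(1 / 2) : ℝ) (3 / 2) ∧ ρ.im ∈ Ioo (-T) T := by
  intro ρ h0 hre him
  rcases zero_continuation_cases hψ hprim hp h𝔪 hnt hL hLs hL' hL's h0 hre.1 hre.2 with ⟨h1, h2⟩ | rfl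
  · obtain ⟨ha, hb⟩ := hgood ρ h0 h1 h2
    refine ⟨⟨by linarith, by linarith⟩, ?_⟩
    exact ⟨lt_of_le_of_ne him.1 (Ne.symm hb), lt_of_le_of_ne him.2 ha⟩
  · simp only [Complex.zero_re, Complex.zero_im, mem_Ioo]
    exact ⟨⟨by norm_num, by norm_num⟩, ⟨by linarith, hT⟩⟩

/-! ## The contour identity at a good height -/

/-- **The contour identity**: `∮_{∂([−1/2,3/2]×[−T,T])} G = 2πi Σ_{ρ ∈ rect, L(ρ)=0} (−m(ρ)) F(s − ρ)` at a good
height `T > 0` (`f` continuous, vanishing on `[x₀, ∞)`, `f(0) = 0`). [folklore] -/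
private theorem rcEF_contour_identity (hψ : IsRayClassCharacter 𝔪 ψ) (hprim : IsPrimitive 𝔪 ψ)
    (hp : IsSignType 𝔪 ψ p) (h𝔪 : 𝔪 ≠ ⊥)
    (hnt : ∃ v : HeightOneSpectrum (𝓞 K), ¬ 𝔪 ≤ v.asIdeal ∧ ψ v ≠ 1)
    {L L' : ℂ → ℂ} (hL : Differentiable ℂ L) (hLs : ∀ s : ℂ, 1 < s.re → L s = rayClassLSeries 𝔪 ψ s)
    (hL' : Differentiable ℂ L') (hL's : ∀ s : ℂ, 1 < s.re → L' s = rayClassLSeries 𝔪 (star ψ) s)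
    {f : ℝ → ℝ} {x₀ : ℝ} (hfc : Continuous f) (hx₀ : 0 ≤ x₀) (hf0 : ∀ u, x₀ ≤ u → f u = 0) (hf00 : f 0 = 0)
    (s : ℂ) {T : ℝ} (hT : 0 < T)
    (hgood : ∀ ρ : ℂ, L ρ = 0 → 0 < ρ.re → ρ.re < 1 → ρ.im ≠ T ∧ ρ.im ≠ -T) :
    rectBoundaryIntegral (rcEFIntegrand L f s) (-(1 / 2)) (3 / 2) (-T) T =
      2 * π * I * ∑ ρ ∈ rectZeros hL (continuation_two_ne_zero h𝔪 hψ hnt hL hLs 0) (-(1 / 2)) (3 / 2) T,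
        (-(analyticOrderNatAt L ρ : ℂ) * fordLaplace₀ f (s - ρ)) := by
  have hΦ : Differentiable ℂ fun w ↦ fordLaplace₀ f (s - w) := by
    have hF := differentiable_fordLaplace hfc hx₀ hf0
    intro w
    have : (fun w ↦ fordLaplace₀ f (s - w)) = fun w ↦ fordLaplace f (s - w) := by
      funext w; exact NumberField.fordLaplace₀_eq_fordLaplace hf00 _
    rw [this]
    exact (hF (s - w)).comp w ((differentiableAt_const _).sub differentiableAt_id)
  have h := rectBoundaryIntegral_neg_logDeriv_mul_eq hL (continuation_two_ne_zero h𝔪 hψ hnt hL hLs 0) hΦ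
    (a := -(1 / 2)) (b := 3 / 2) (by norm_num) hT
    (rect_boundary_free' hψ hprim hp h𝔪 hnt hL hLs hL' hL's hT hgood)
  have heq : rcEFIntegrand L f s = fun w ↦ -logDeriv L w * fordLaplace₀ f (s - w) := by
    funext w; rw [rcEFIntegrand]
  rw [heq, h]

/-! ## Absolute convergence of the zero sum -/

/-- The non-trivial zeros of `L` with `|γ| ≤ Y` form a finite set. [folklore] -/
private theorem finite_zeroBox' (h𝔪 : 𝔪 ≠ ⊥) (hψ : IsRayClassCharacter 𝔪 ψ)
    (hnt : ∃ v : HeightOneSpectrum (𝓞 K), ¬ 𝔪 ≤ v.asIdeal ∧ ψ v ≠ 1) {L : ℂ → ℂ}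
    (hL : Differentiable ℂ L) (hLs : ∀ s : ℂ, 1 < s.re → L s = rayClassLSeries 𝔪 ψ s) (Y : ℝ) :
    {ρ : ℂ | L ρ = 0 ∧ 0 < ρ.re ∧ ρ.re < 1 ∧ |ρ.im| ≤ Y}.Finite := by
  refine (finite_nontrivialZeros_inter hL (continuation_two_ne_zero h𝔪 hψ hnt hL hLs 0) Y).subset ?_
  rintro ρ ⟨h0, h1, h2, h3⟩
  exact ⟨⟨h0, h1, h2⟩, h3⟩

/-- The non-trivial zeros stay at a positive distance from a point `s` that is not one of them. [folklore] -/
private theorem exists_dist_rcZeros_ge (h𝔪 : 𝔪 ≠ ⊥) (hψ : IsRayClassCharacter 𝔪 ψ)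
    (hnt : ∃ v : HeightOneSpectrum (𝓞 K), ¬ 𝔪 ≤ v.asIdeal ∧ ψ v ≠ 1) {L : ℂ → ℂ}
    (hL : Differentiable ℂ L) (hLs : ∀ s : ℂ, 1 < s.re → L s = rayClassLSeries 𝔪 ψ s) {s : ℂ}
    (hsz : ∀ ρ : ℂ, L ρ = 0 → 0 < ρ.re → ρ.re < 1 → ρ ≠ s) :
    ∃ d : ℝ, 0 < d ∧ d ≤ 1 ∧ ∀ ρ ∈ nontrivialZeros L, d ≤ ‖s - ρ‖ := by
  classical
  have hfin := finite_zeroBox' h𝔪 hψ hnt hL hLs (|s.im| + 1)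
  set A : Finset ℝ := insert 1 (hfin.toFinset.image fun ρ ↦ ‖s - ρ‖) with hA
  have hne : A.Nonempty := ⟨1, Finset.mem_insert_self _ _⟩
  have hpos : ∀ a ∈ A, 0 < a := by
    intro a ha
    rw [hA, Finset.mem_insert, Finset.mem_image] at ha
    rcases ha with rfl | ⟨ρ, hρ, rfl⟩
    · exact one_pos
    · rw [Set.Finite.mem_toFinset] at hρ
      exact norm_pos_iff.2 (sub_ne_zero.2 (Ne.symm (hsz ρ hρ.1 hρ.2.1 hρ.2.2.1)))
  refine ⟨A.min' hne, hpos _ (Finset.min'_mem _ _), Finset.min'_le _ _ (Finset.mem_insert_self _ _), fun ρ hρ ↦ ?_⟩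
  by_cases hγ : |ρ.im| ≤ |s.im| + 1
  · refine Finset.min'_le _ _ ?_
    rw [hA, Finset.mem_insert, Finset.mem_image]
    refine Or.inr ⟨ρ, ?_, rfl⟩
    rw [Set.Finite.mem_toFinset]
    exact ⟨hρ.1, hρ.2.1, hρ.2.2, hγ⟩
  · push Not at hγ
    have h1 : (1 : ℝ) ≤ ‖s - ρ‖ := by
      have := Complex.abs_im_le_norm (s - ρ)
      rw [sub_im] at this
      have h2 : |ρ.im| - |s.im| ≤ |s.im - ρ.im| := by
        have := abs_sub_abs_le_abs_sub ρ.im s.im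
        rwa [abs_sub_comm] at this
      linarith
    exact (Finset.min'_le _ _ (Finset.mem_insert_self _ _)).trans h1

/-- The window bound in the abstract form: `Σ_{window} m ≤ 128(n_K+1)(A + log(|τ| + 4))`, `A = log(|d_K|𝔑𝔪) + 3n_K`.
[folklore] -/
private theorem window_bound_continuation (hψ : IsRayClassCharacter 𝔪 ψ) (hprim : IsPrimitive 𝔪 ψ)
    (hp : IsSignType 𝔪 ψ p) (h𝔪 : 𝔪 ≠ ⊥)
    (hnt : ∃ v : HeightOneSpectrum (𝓞 K), ¬ 𝔪 ≤ v.asIdeal ∧ ψ v ≠ 1)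
    {L L' : ℂ → ℂ} (hL : Differentiable ℂ L) (hLs : ∀ s : ℂ, 1 < s.re → L s = rayClassLSeries 𝔪 ψ s)
    (hL' : Differentiable ℂ L') (hL's : ∀ s : ℂ, 1 < s.re → L' s = rayClassLSeries 𝔪 (star ψ) s)
    (τ : ℝ) (P : Finset ℂ) (hP : ∀ ρ ∈ P, L ρ = 0 ∧ 0 < ρ.re ∧ ρ.re < 1 ∧ |ρ.im - τ| ≤ 1 / 2) :
    ∑ ρ ∈ P, (analyticOrderNatAt L ρ : ℝ) ≤
      (128 * (Module.finrank ℚ K + 1)) *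
        ((Real.log (|(discr K : ℝ)| * (Ideal.absNorm 𝔪 : ℝ)) + 3 * Module.finrank ℚ K) + Real.log (|τ| + 4)) := by
  have h := sum_window_continuation_le hψ hprim hp h𝔪 hnt hL hLs hL' hL's τ P hP
  simp only [zeroOrder] at h
  refine h.trans ?_
  have hl := NumberField.log_abs_add_seven_le τ
  have hd : 0 ≤ Real.log (|(discr K : ℝ)| * (Ideal.absNorm 𝔪 : ℝ)) := by
    refine Real.log_nonneg ?_
    have h1 : (1 : ℝ) ≤ |(discr K : ℝ)| := by
      have := Int.one_le_abs (discr_ne_zero K)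
      rw [← Int.cast_abs]; exact_mod_cast this
    have h2 : (1 : ℝ) ≤ (Ideal.absNorm 𝔪 : ℝ) := by
      exact_mod_cast Nat.one_le_iff_ne_zero.mpr (by rwa [ne_eq, Ideal.absNorm_eq_zero_iff])
    nlinarith
  have hn : (0 : ℝ) ≤ Module.finrank ℚ K := Nat.cast_nonneg _
  have hl4 : 0 ≤ Real.log (|τ| + 4) := Real.log_nonneg (by linarith [abs_nonneg τ])
  have hl7 : 0 ≤ Real.log (|τ| + 7) := Real.log_nonneg (by linarith [abs_nonneg τ])
  nlinarith [mul_nonneg hn hl4, mul_nonneg hn hl7, mul_le_mul_of_nonneg_left hl hn]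

/-- **Absolute convergence of the zero sum** `Σ_ρ m(ρ) F(s − ρ)` over the non-trivial zeros of `L`
(admissible `f`, `Re s > −1`, `s` not a non-trivial zero). [cite: HeathBrown1992PLMS, Lemma 5.1] -/
theorem summable_norm_rcZeroTerm (hψ : IsRayClassCharacter 𝔪 ψ) (hprim : IsPrimitive 𝔪 ψ)
    (hp : IsSignType 𝔪 ψ p) (h𝔪 : 𝔪 ≠ ⊥)
    (hnt : ∃ v : HeightOneSpectrum (𝓞 K), ¬ 𝔪 ≤ v.asIdeal ∧ ψ v ≠ 1)
    {L L' : ℂ → ℂ} (hL : Differentiable ℂ L) (hLs : ∀ s : ℂ, 1 < s.re → L s = rayClassLSeries 𝔪 ψ s)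
    (hL' : Differentiable ℂ L') (hL's : ∀ s : ℂ, 1 < s.re → L' s = rayClassLSeries 𝔪 (star ψ) s)
    {f p₀ p' p'' : ℝ → ℝ} {x₀ : ℝ} (h : IsSmoothedEFTest f p₀ p' p'' x₀) {s : ℂ} (hσ₁ : -1 < s.re)
    (hsz : ∀ ρ : ℂ, L ρ = 0 → 0 < ρ.re → ρ.re < 1 → ρ ≠ s) :
    Summable fun ρ : nontrivialZeros L ↦ ‖(analyticOrderNatAt L (ρ : ℂ) : ℂ) * fordLaplace₀ f (s - ρ)‖ := by
  obtain ⟨d, hd0, hd1, hd⟩ := exists_dist_rcZeros_ge h𝔪 hψ hnt hL hLs hsz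
  set D := SmoothedEF.decayConst p' p'' x₀ with hD
  have hD0 : 0 ≤ D := SmoothedEF.decayConst_nonneg h.x₀_nonneg
  set C : ℝ := (1 + 2 * s.im ^ 2) / d ^ 2 + 2 with hC
  have hA0 : 0 ≤ Real.log (|(discr K : ℝ)| * (Ideal.absNorm 𝔪 : ℝ)) + 3 * Module.finrank ℚ K := by
    have : 0 ≤ Real.log (|(discr K : ℝ)| * (Ideal.absNorm 𝔪 : ℝ)) := by
      refine Real.log_nonneg ?_
      have h1 : (1 : ℝ) ≤ |(discr K : ℝ)| := by
        have := Int.one_le_abs (discr_ne_zero K)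
        rw [← Int.cast_abs]; exact_mod_cast this
      have h2 : (1 : ℝ) ≤ (Ideal.absNorm 𝔪 : ℝ) := by
        exact_mod_cast Nat.one_le_iff_ne_zero.mpr (by rwa [ne_eq, Ideal.absNorm_eq_zero_iff])
      nlinarith
    positivity
  refine summable_of_norm_le_mul_div (by positivity) hA0
    (window_bound_continuation hψ hprim hp h𝔪 hnt hL hLs hL' hL's) (B := D * C) fun ρ ↦ ?_
  have hm : (0 : ℝ) ≤ analyticOrderNatAt L (ρ : ℂ) := Nat.cast_nonneg _
  have hρ := ρ.2
  have hre0 := hρ.2.1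
  have hre1 := hρ.2.2
  have hdρ := hd _ hρ
  have hne : s - (ρ : ℂ) ≠ 0 := norm_pos_iff.1 (hd0.trans_le hdρ)
  have hF := SmoothedEF.norm_fordLaplace₀_le h hne (by rw [sub_re]; linarith)
  rw [norm_mul, Complex.norm_natCast]
  have hd2 : d ^ 2 ≤ ‖s - ρ‖ ^ 2 := by nlinarith [norm_nonneg (s - (ρ : ℂ))]
  have hkey : 1 + (ρ : ℂ).im ^ 2 ≤ C * ‖s - ρ‖ ^ 2 := by
    have hn2 : (s.im - (ρ : ℂ).im) ^ 2 ≤ ‖s - ρ‖ ^ 2 := by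
      have := Complex.abs_im_le_norm (s - ρ)
      rw [sub_im] at this
      nlinarith [abs_nonneg (s.im - (ρ : ℂ).im), sq_abs (s.im - (ρ : ℂ).im)]
    have h1 : (ρ : ℂ).im ^ 2 ≤ 2 * (s.im - (ρ : ℂ).im) ^ 2 + 2 * s.im ^ 2 := by
      nlinarith [sq_nonneg (s.im - 2 * (ρ : ℂ).im), sq_nonneg ((ρ : ℂ).im - 2 * s.im), sq_nonneg (2 * s.im - (ρ : ℂ).im)]
    have h2 : 1 + 2 * s.im ^ 2 ≤ (1 + 2 * s.im ^ 2) / d ^ 2 * ‖s - ρ‖ ^ 2 := by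
      rw [div_mul_eq_mul_div, le_div_iff₀ (by positivity)]
      exact mul_le_mul_of_nonneg_left hd2 (by positivity)
    calc 1 + (ρ : ℂ).im ^ 2 ≤ (1 + 2 * s.im ^ 2) + 2 * (s.im - (ρ : ℂ).im) ^ 2 := by linarith
      _ ≤ (1 + 2 * s.im ^ 2) / d ^ 2 * ‖s - ρ‖ ^ 2 + 2 * ‖s - ρ‖ ^ 2 := by linarith
      _ = C * ‖s - ρ‖ ^ 2 := by rw [hC]; ring
  have hpos : 0 < ‖s - (ρ : ℂ)‖ ^ 2 := by positivity
  calc (analyticOrderNatAt L (ρ : ℂ) : ℝ) * ‖fordLaplace₀ f (s - ρ)‖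
      ≤ (analyticOrderNatAt L (ρ : ℂ) : ℝ) * (D / ‖s - ρ‖ ^ 2) := mul_le_mul_of_nonneg_left hF hm
    _ ≤ (analyticOrderNatAt L (ρ : ℂ) : ℝ) * (D * C / (1 + (ρ : ℂ).im ^ 2)) := by
        refine mul_le_mul_of_nonneg_left ?_ hm
        rw [div_le_div_iff₀ hpos (by positivity)]
        calc D * (1 + (ρ : ℂ).im ^ 2) ≤ D * (C * ‖s - ρ‖ ^ 2) := mul_le_mul_of_nonneg_left hkey hD0
          _ = D * C * ‖s - ρ‖ ^ 2 := by ring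
    _ = D * C * ((analyticOrderNatAt L (ρ : ℂ) : ℝ) / (1 + (ρ : ℂ).im ^ 2)) := by ring

/-! ## The left line `Re w = −1/2` -/

/-- `L ≠ 0` on `Re w = −1/2` (reflection: `L̄(3/2 − iy) ≠ 0`). [folklore] -/
private theorem continuation_leftLine_ne_zero (hψ : IsRayClassCharacter 𝔪 ψ) (hprim : IsPrimitive 𝔪 ψ)
    (hp : IsSignType 𝔪 ψ p) (h𝔪 : 𝔪 ≠ ⊥)
    (hnt : ∃ v : HeightOneSpectrum (𝓞 K), ¬ 𝔪 ≤ v.asIdeal ∧ ψ v ≠ 1)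
    {L L' : ℂ → ℂ} (hL : Differentiable ℂ L) (hLs : ∀ s : ℂ, 1 < s.re → L s = rayClassLSeries 𝔪 ψ s)
    (hL' : Differentiable ℂ L') (hL's : ∀ s : ℂ, 1 < s.re → L' s = rayClassLSeries 𝔪 (star ψ) s) (y : ℝ) :
    L (((-(1 / 2) : ℝ) : ℂ) + y * I) ≠ 0 := by
  set w : ℂ := ((-(1 / 2) : ℝ) : ℂ) + y * I with hw
  have hwre : w.re = -1 / 2 := by simp [hw]; norm_num
  have hwZ : ∀ n : ℤ, w ≠ n := fun n h ↦ by
    have := congrArg Complex.re h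
    rw [hwre] at this; simp at this
    have h2 : (2 * n : ℝ) = -1 := by linarith
    have h3 : (2 * n : ℤ) = -1 := by exact_mod_cast h2
    omega
  have hL'w : L' (1 - w) ≠ 0 :=
    continuation_ne_zero_of_one_le_re' h𝔪 hψ.star (star_nontrivial'' hnt) hL' hL's (by simp [hwre]; norm_num)
  exact (logDeriv_continuation_reflect hψ hprim hp h𝔪 hL hLs hL' hL's hwZ hL'w).1

/-- The integrand `y ↦ G(−1/2 + iy)` is continuous (`f(0) = 0`). [folklore] -/
private theorem continuous_rcIntegrand_left (hψ : IsRayClassCharacter 𝔪 ψ) (hprim : IsPrimitive 𝔪 ψ)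
    (hp : IsSignType 𝔪 ψ p) (h𝔪 : 𝔪 ≠ ⊥)
    (hnt : ∃ v : HeightOneSpectrum (𝓞 K), ¬ 𝔪 ≤ v.asIdeal ∧ ψ v ≠ 1)
    {L L' : ℂ → ℂ} (hL : Differentiable ℂ L) (hLs : ∀ s : ℂ, 1 < s.re → L s = rayClassLSeries 𝔪 ψ s)
    (hL' : Differentiable ℂ L') (hL's : ∀ s : ℂ, 1 < s.re → L' s = rayClassLSeries 𝔪 (star ψ) s)
    {f : ℝ → ℝ} {x₀ : ℝ} (hfc : Continuous f) (hx₀ : 0 ≤ x₀) (hf0 : ∀ u, x₀ ≤ u → f u = 0) (hf00 : f 0 = 0)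
    (s : ℂ) :
    Continuous fun y : ℝ ↦ rcEFIntegrand L f s (((-(1 / 2) : ℝ) : ℂ) + y * I) := by
  set Lv : ℝ → ℂ := fun y : ℝ ↦ (((-(1 / 2) : ℝ) : ℂ) + y * I) with hLv
  have hline : Continuous Lv := by rw [hLv]; fun_prop
  have hcomp : (fun y : ℝ ↦ rcEFIntegrand L f s (((-(1 / 2) : ℝ) : ℂ) + y * I)) =
      (fun w ↦ -logDeriv L w * fordLaplace₀ f (s - w)) ∘ Lv := rfl
  rw [hcomp]
  refine continuous_iff_continuousAt.2 fun y ↦ ContinuousAt.comp (x := y) ?_ hline.continuousAt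
  have hL0 : L (Lv y) ≠ 0 := continuation_leftLine_ne_zero hψ hprim hp h𝔪 hnt hL hLs hL' hL's y
  have han : AnalyticAt ℂ L (Lv y) := hL.analyticAt _
  have hF := differentiable_fordLaplace hfc hx₀ hf0
  have hΦ : ContinuousAt (fun w ↦ fordLaplace₀ f (s - w)) (Lv y) := by
    have : (fun w ↦ fordLaplace₀ f (s - w)) = fun w ↦ fordLaplace f (s - w) := by
      funext w; exact NumberField.fordLaplace₀_eq_fordLaplace hf00 _
    rw [this]
    exact ((hF (s - Lv y)).comp (Lv y) ((differentiableAt_const _).sub differentiableAt_id)).continuousAt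
  have hld : ContinuousAt (logDeriv L) (Lv y) := by
    have h1 : ContinuousAt (fun z ↦ deriv L z / L z) (Lv y) := han.deriv.continuousAt.div han.continuousAt hL0
    have h2 : logDeriv L = fun z ↦ deriv L z / L z := by
      funext z; rw [logDeriv_apply]
    rw [h2]; exact h1
  exact hld.neg.mul hΦ

/-- **The left-line integrand is integrable on `ℝ`** (`Re s > −1/2`):
`|L'/L(−1/2 + iy)| ≪ log(|d_K|𝔑𝔪) + log(|y| + 4)` against `|F| ≤ D/((σ + 1/2)² + (t − y)²)`.
[cite: LagariasOdlyzko1977, §7 (7.4)] -/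
theorem integrable_rcIntegrand_left (hψ : IsRayClassCharacter 𝔪 ψ) (hprim : IsPrimitive 𝔪 ψ)
    (hp : IsSignType 𝔪 ψ p) (h𝔪 : 𝔪 ≠ ⊥)
    (hnt : ∃ v : HeightOneSpectrum (𝓞 K), ¬ 𝔪 ≤ v.asIdeal ∧ ψ v ≠ 1)
    {L L' : ℂ → ℂ} (hL : Differentiable ℂ L) (hLs : ∀ s : ℂ, 1 < s.re → L s = rayClassLSeries 𝔪 ψ s)
    (hL' : Differentiable ℂ L') (hL's : ∀ s : ℂ, 1 < s.re → L' s = rayClassLSeries 𝔪 (star ψ) s)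
    {f p₀ p' p'' : ℝ → ℝ} {x₀ : ℝ} (h : IsSmoothedEFTest f p₀ p' p'' x₀) (hf00 : f 0 = 0) {s : ℂ}
    (hσ₁ : -(1 / 2) < s.re) :
    Integrable fun y : ℝ ↦ rcEFIntegrand L f s (((-(1 / 2) : ℝ) : ℂ) + y * I) := by
  obtain ⟨A, hA0, hA⟩ := exists_norm_logDeriv_continuation_left_le
  set D := SmoothedEF.decayConst p' p'' x₀ with hD
  have hD0 : 0 ≤ D := SmoothedEF.decayConst_nonneg h.x₀_nonneg
  set n : ℝ := (Module.finrank ℚ K : ℝ) with hn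
  have hn0 : 0 ≤ n := Nat.cast_nonneg _
  set A' : ℝ := |(discr K : ℝ)| * (Ideal.absNorm 𝔪 : ℝ) with hA'
  have hd0 : 0 ≤ Real.log A' := by
    refine Real.log_nonneg ?_
    have h1 : (1 : ℝ) ≤ |(discr K : ℝ)| := by
      have := Int.one_le_abs (discr_ne_zero K)
      rw [← Int.cast_abs]; exact_mod_cast this
    have h2 : (1 : ℝ) ≤ (Ideal.absNorm 𝔪 : ℝ) := by
      exact_mod_cast Nat.one_le_iff_ne_zero.mpr (by rwa [ne_eq, Ideal.absNorm_eq_zero_iff])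
    rw [hA']; nlinarith
  set M : ℝ := A * (n + 1) with hM
  have hM0 : 0 ≤ M := by positivity
  set A₀ : ℝ := Real.log A' + Real.log 4 with hA₀
  have hA₀0 : 0 ≤ A₀ := by have : 0 ≤ Real.log 4 := Real.log_nonneg (by norm_num); positivity
  set a : ℝ := s.re + 1 / 2 with ha
  have ha0 : 0 < a := by rw [ha]; linarith
  refine (((SmoothedEF.integrable_left_majorant' (A := A₀) hA₀0 ha0 (t := s.im)).const_mul (M * D))).mono'
    (continuous_rcIntegrand_left hψ hprim hp h𝔪 hnt hL hLs hL' hL's h.cont h.x₀_nonneg h.eq_zero hf00 s).aestronglyMeasurable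
    (ae_of_all _ fun y ↦ ?_)
  set w : ℂ := ((-(1 / 2) : ℝ) : ℂ) + y * I with hw
  have hsw_re : (s - w).re = a := by simp [hw, ha]
  have hsw_im : (s - w).im = s.im - y := by simp [hw]
  have hsw : s - w ≠ 0 := fun h0 ↦ by
    have := congrArg Complex.re h0
    rw [hsw_re, Complex.zero_re] at this
    linarith
  have hnorm : ‖s - w‖ ^ 2 = a ^ 2 + (s.im - y) ^ 2 := by
    rw [Complex.sq_norm, Complex.normSq_apply, hsw_re, hsw_im]; ring
  have hF : ‖fordLaplace₀ f (s - w)‖ ≤ D / (a ^ 2 + (s.im - y) ^ 2) := by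
    rw [← hnorm]
    exact SmoothedEF.norm_fordLaplace₀_le h hsw (by rw [hsw_re]; linarith)
  rw [rcEFIntegrand, norm_mul, norm_neg]
  have hw' : w = -1 / 2 + y * I := by rw [hw]; push_cast; ring
  have hb := hA K 𝔪 ψ p hψ hprim hp h𝔪 L L' hL hLs hL' hL's y
  rw [← hw'] at hb
  have hlog4 : Real.log (|y| + 4) ≤ Real.log 4 + Real.log (1 + |y|) := by
    rw [← Real.log_mul (by norm_num) (by linarith [abs_nonneg y])]
    exact Real.log_le_log (by linarith [abs_nonneg y]) (by nlinarith [abs_nonneg y])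
  have hl1 : 0 ≤ Real.log (1 + |y|) := Real.log_nonneg (by linarith [abs_nonneg y])
  have hb' : ‖logDeriv L w‖ ≤ M * (A₀ + 2 * Real.log (1 + |y|)) := by
    refine hb.trans ?_
    rw [hM, hA₀, ← hn]
    have : Real.log A' + Real.log (|y| + 4) ≤ Real.log A' + Real.log 4 + 2 * Real.log (1 + |y|) := by linarith
    exact mul_le_mul_of_nonneg_left this (by positivity)
  have hC1 : 0 ≤ M * (A₀ + 2 * Real.log (1 + |y|)) := by positivity
  calc ‖logDeriv L w‖ * ‖fordLaplace₀ f (s - w)‖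
      ≤ (M * (A₀ + 2 * Real.log (1 + |y|))) * (D / (a ^ 2 + (s.im - y) ^ 2)) := mul_le_mul hb' hF (norm_nonneg _) hC1
    _ = M * D * ((A₀ + 2 * Real.log (1 + |y|)) / (a ^ 2 + (s.im - y) ^ 2)) := by ring

/-! ## The right line `Re w = 3/2` -/

/-- On the right line the integrand is that of the prime side:
`∫_ℝ G(3/2 + iv) dv = 2π K_{f,Λ_χ}(s)` and the integrand is integrable (`Re s < 3/2`). [folklore] -/
private theorem integral_rcIntegrand_right (h𝔪 : 𝔪 ≠ ⊥) (hψ : IsRayClassCharacter 𝔪 ψ)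
    {L : ℂ → ℂ} (hLs : ∀ s : ℂ, 1 < s.re → L s = rayClassLSeries 𝔪 ψ s)
    {f p₀ p' p'' : ℝ → ℝ} {x₀ : ℝ} (h : IsSmoothedEFTest f p₀ p' p'' x₀) {s : ℂ} (hσ₂ : s.re < 3 / 2) :
    Integrable (fun v : ℝ ↦ rcEFIntegrand L f s (((3 / 2 : ℝ) : ℂ) + v * I)) ∧
      ∫ v : ℝ, rcEFIntegrand L f s (((3 / 2 : ℝ) : ℂ) + v * I) = 2 * π * NumberField.coefFordK (rcCoef 𝔪 ψ) f s := by
  have hα : (1 : ℝ) < 3 / 2 := by norm_num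
  have hint : Integrable fun y : ℝ ↦ fordLaplace₀ f ((s.re - 3 / 2 : ℝ) + y * I) :=
    SmoothedEF.integrable_vertical h (by linarith)
  have ha : ∀ n, ‖rcCoef 𝔪 ψ n‖ ≤ (Module.finrank ℚ K : ℝ) * Λ n := norm_rcCoef_le h𝔪 hψ
  have hψ1 : ∀ v : HeightOneSpectrum (𝓞 K), ¬ 𝔪 ≤ v.asIdeal → ‖ψ v‖ ≤ 1 := fun v hv ↦ (hψ.norm_eq_one v hv).le
  have heq : (fun v : ℝ ↦ rcEFIntegrand L f s (((3 / 2 : ℝ) : ℂ) + v * I)) = fun v : ℝ ↦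
      LSeries (rcCoef 𝔪 ψ) (((3 / 2 : ℝ) : ℂ) + v * I) * fordLaplace₀ f (s - ((3 / 2 : ℝ) + v * I)) := by
    funext v
    have h1 : 1 < ((((3 / 2 : ℝ)) : ℂ) + v * I).re := by simp; norm_num
    rw [rcEFIntegrand, logDeriv_apply, neg_logDeriv_continuation_eq_LSeries h𝔪 hψ1 hLs h1]
  rw [heq]
  exact ⟨NumberField.integrable_LSeries_coef_mul_fordLaplace₀ ha hα hint,
    NumberField.integral_LSeries_coef_mul_fordLaplace₀ ha h.cont h.eq_zero hα hσ₂ hint⟩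

/-! ## The horizontal sides -/

/-- **The horizontal sides are small**: at a height `T` with `|T| ≥ 2`, the zeros of `L` `η`-separated from
`T` and those of `L̄` from `−T`, for `|Im s| < |T|` and `Re s > −1/2`:
`‖∫_{−1/2}^{3/2} G(σ + iT) dσ‖ ≤ (80000 M(T)/η) · D/(|T| − |Im s|)² · 2`. [folklore] -/
private theorem norm_integral_rcIntegrand_horizontal_le (hψ : IsRayClassCharacter 𝔪 ψ) (hprim : IsPrimitive 𝔪 ψ)
    (hp : IsSignType 𝔪 ψ p) (h𝔪 : 𝔪 ≠ ⊥)
    (hnt : ∃ v : HeightOneSpectrum (𝓞 K), ¬ 𝔪 ≤ v.asIdeal ∧ ψ v ≠ 1)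
    {L L' : ℂ → ℂ} (hL : Differentiable ℂ L) (hLs : ∀ s : ℂ, 1 < s.re → L s = rayClassLSeries 𝔪 ψ s)
    (hL' : Differentiable ℂ L') (hL's : ∀ s : ℂ, 1 < s.re → L' s = rayClassLSeries 𝔪 (star ψ) s)
    {f p₀ p' p'' : ℝ → ℝ} {x₀ : ℝ} (h : IsSmoothedEFTest f p₀ p' p'' x₀) {s : ℂ} (hσ₁ : -(1 / 2) < s.re)
    {T η : ℝ} (hT : 2 ≤ |T|) (hsT : |s.im| < |T|) (hη : 0 < η) (hη1 : η ≤ 1)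
    (hsep : ∀ ρ : ℂ, L ρ = 0 → 0 < ρ.re → ρ.re < 1 → η ≤ |ρ.im - T|)
    (hsep' : ∀ ρ : ℂ, L' ρ = 0 → 0 < ρ.re → ρ.re < 1 → η ≤ |ρ.im - -T|) :
    ‖∫ σ : ℝ in (-(1 / 2) : ℝ)..(3 / 2), rcEFIntegrand L f s (σ + T * I)‖ ≤
      80000 * (Real.log (|(discr K : ℝ)| * (Ideal.absNorm 𝔪 : ℝ)) + 3 * Module.finrank ℚ K +
        Module.finrank ℚ K * Real.log (|T| + 7)) / η * (SmoothedEF.decayConst p' p'' x₀ / (|T| - |s.im|) ^ 2) * 2 := by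
  set D := SmoothedEF.decayConst p' p'' x₀ with hD
  set ℳ : ℝ := Real.log (|(discr K : ℝ)| * (Ideal.absNorm 𝔪 : ℝ)) + 3 * Module.finrank ℚ K +
    Module.finrank ℚ K * Real.log (|T| + 7) with hℳ
  have hD0 : 0 ≤ D := SmoothedEF.decayConst_nonneg h.x₀_nonneg
  have hgap : 0 < |T| - |s.im| := by linarith
  have hT0 : T ≠ 0 := fun h0 ↦ by rw [h0, abs_zero] at hT; linarith
  have hbound : ∀ σ ∈ Set.uIoc (-(1 / 2) : ℝ) (3 / 2), ‖rcEFIntegrand L f s (σ + T * I)‖ ≤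
      80000 * ℳ / η * (D / (|T| - |s.im|) ^ 2) := by
    intro σ hσ
    rw [Set.uIoc_of_le (by norm_num)] at hσ
    set w : ℂ := (σ : ℂ) + T * I with hw
    have hsw_im : (s - w).im = s.im - T := by simp [hw]
    have hsw_re : (s - w).re = s.re - σ := by simp [hw]
    have him : |T| - |s.im| ≤ |(s - w).im| := by
      rw [hsw_im]
      have := abs_sub_abs_le_abs_sub T s.im
      rw [abs_sub_comm] at this
      linarith
    have hnorm : |T| - |s.im| ≤ ‖s - w‖ := him.trans (Complex.abs_im_le_norm _)
    have hsw : s - w ≠ 0 := norm_pos_iff.1 (hgap.trans_le hnorm)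
    have hF : ‖fordLaplace₀ f (s - w)‖ ≤ D / (|T| - |s.im|) ^ 2 := by
      refine (SmoothedEF.norm_fordLaplace₀_le h hsw (by rw [hsw_re]; linarith [hσ.2])).trans ?_
      exact div_le_div_of_nonneg_left hD0 (by positivity) (by gcongr)
    obtain ⟨-, hLb⟩ := norm_logDeriv_continuation_le_strip hψ hprim hp h𝔪 hnt hL hLs hL' hL's hT hη hη1 hsep hsep'
      hσ.1.le hσ.2
    have hlog : 0 ≤ 80000 * ℳ / η := le_trans (norm_nonneg _) hLb
    rw [rcEFIntegrand, norm_mul, norm_neg]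
    exact mul_le_mul hLb hF (norm_nonneg _) hlog
  refine (intervalIntegral.norm_integral_le_of_norm_le_const hbound).trans_eq ?_
  norm_num

/-! ## The zeros in the rectangle: the box of non-trivial zeros and the trivial zero `0` -/

/-- The sum over the zeros of `L` in `[−1/2, 3/2] × [−T, T]` splits into the non-trivial zeros with `|γ| ≤ T` and
the possible trivial zero at `0` (weight `m₀ = ord₀ L`). [folklore] -/
private theorem sum_rectZeros_continuation (hψ : IsRayClassCharacter 𝔪 ψ) (hprim : IsPrimitive 𝔪 ψ)
    (hp : IsSignType 𝔪 ψ p) (h𝔪 : 𝔪 ≠ ⊥)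
    (hnt : ∃ v : HeightOneSpectrum (𝓞 K), ¬ 𝔪 ≤ v.asIdeal ∧ ψ v ≠ 1)
    {L L' : ℂ → ℂ} (hL : Differentiable ℂ L) (hLs : ∀ s : ℂ, 1 < s.re → L s = rayClassLSeries 𝔪 ψ s)
    (hL' : Differentiable ℂ L') (hL's : ∀ s : ℂ, 1 < s.re → L' s = rayClassLSeries 𝔪 (star ψ) s)
    {T : ℝ} (hT : 0 < T) (g : ℂ → ℂ) :
    ∑ ρ ∈ rectZeros hL (continuation_two_ne_zero h𝔪 hψ hnt hL hLs 0) (-(1 / 2)) (3 / 2) T,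
        (-(analyticOrderNatAt L ρ : ℂ) * g ρ) =
      ∑ ρ ∈ (finite_nontrivialZeros_inter hL (continuation_two_ne_zero h𝔪 hψ hnt hL hLs 0) T).toFinset,
        (-(analyticOrderNatAt L ρ : ℂ) * g ρ) +
      (-(analyticOrderNatAt L 0 : ℂ) * g 0) := by
  classical
  have hc : L (2 + ((0 : ℝ) : ℂ) * I) ≠ 0 := continuation_two_ne_zero h𝔪 hψ hnt hL hLs 0
  set R := rectZeros hL hc (-(1 / 2)) (3 / 2) T with hR
  set B := (finite_nontrivialZeros_inter hL hc T).toFinset with hB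
  have hmemB : ∀ ρ, ρ ∈ B ↔ (L ρ = 0 ∧ 0 < ρ.re ∧ ρ.re < 1) ∧ |ρ.im| ≤ T := by
    intro ρ; rw [hB, Set.Finite.mem_toFinset]; rfl
  have h0B : (0 : ℂ) ∉ B := fun h ↦ by
    have := ((hmemB 0).1 h).1.2.1; simp at this
  by_cases h0 : L 0 = 0
  · have hR_eq : R = insert 0 B := by
      ext ρ
      rw [Finset.mem_insert, hmemB, hR, mem_rectZeros]
      constructor
      · rintro ⟨⟨hre, him⟩, hρ0⟩
        rcases zero_continuation_cases hψ hprim hp h𝔪 hnt hL hLs hL' hL's hρ0 hre.1 hre.2 with ⟨h1, h2⟩ | h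
        · exact Or.inr ⟨⟨hρ0, h1, h2⟩, abs_le.2 ⟨him.1, him.2⟩⟩
        · exact Or.inl h
      · rintro (rfl | ⟨⟨hρ0, h1, h2⟩, him⟩)
        · refine ⟨⟨⟨by norm_num, by norm_num⟩, ?_⟩, h0⟩
          simp only [Complex.zero_im, mem_Icc]; exact ⟨by linarith, hT.le⟩
        · exact ⟨⟨⟨by linarith, by linarith⟩, abs_le.1 him⟩, hρ0⟩
    rw [hR_eq, Finset.sum_insert h0B, add_comm]
  · have hm0 : analyticOrderNatAt L 0 = 0 := by
      have := (hL.analyticAt 0).analyticOrderAt_eq_zero.2 h0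
      rw [analyticOrderNatAt, this]; rfl
    have hR_eq : R = B := by
      ext ρ
      rw [hmemB, hR, mem_rectZeros]
      constructor
      · rintro ⟨⟨hre, him⟩, hρ0⟩
        rcases zero_continuation_cases hψ hprim hp h𝔪 hnt hL hLs hL' hL's hρ0 hre.1 hre.2 with ⟨h1, h2⟩ | h
        · exact ⟨⟨hρ0, h1, h2⟩, abs_le.2 ⟨him.1, him.2⟩⟩
        · exact absurd hρ0 (h ▸ h0)
      · rintro ⟨⟨hρ0, h1, h2⟩, him⟩
        exact ⟨⟨⟨by linarith, by linarith⟩, abs_le.1 him⟩, hρ0⟩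
    rw [hR_eq, hm0]; simp

/-! ## The limit `T → ∞`: the exact explicit formula -/

set_option maxHeartbeats 800000 in
/-- **The smoothed explicit formula for the Hecke `L`-series of a primitive ray class character, exact form**
(Lagarias–Odlyzko §7 / Thorner–Zaman Lemma 4.3 for a single character): for an admissible smoothing `f` with
`f(0) = 0` and `−1/2 < Re s < 3/2`, `s` not a non-trivial zero of `L`,
`Σ_n Λ_χ(n) f(log n) n^{−s} = −Σ_ρ m(ρ) F(s − ρ) − m₀ F(s) + J(s)`, `ρ` over the non-trivial zeros of `L`
(absolutely convergent), `m₀ = ord₀ L`, `J` the left-line integral (`rcEFRemainder`).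
[cite: LagariasOdlyzko1977, §7 (7.2)] [cite: ThornerZaman2019, Lemma 4.3] -/
theorem rcCoefFordK_eq_explicit (hψ : IsRayClassCharacter 𝔪 ψ) (hprim : IsPrimitive 𝔪 ψ)
    (hp : IsSignType 𝔪 ψ p) (h𝔪 : 𝔪 ≠ ⊥)
    (hnt : ∃ v : HeightOneSpectrum (𝓞 K), ¬ 𝔪 ≤ v.asIdeal ∧ ψ v ≠ 1)
    {L L' : ℂ → ℂ} (hL : Differentiable ℂ L) (hLs : ∀ s : ℂ, 1 < s.re → L s = rayClassLSeries 𝔪 ψ s)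
    (hL' : Differentiable ℂ L') (hL's : ∀ s : ℂ, 1 < s.re → L' s = rayClassLSeries 𝔪 (star ψ) s)
    {f p₀ p' p'' : ℝ → ℝ} {x₀ : ℝ} (h : IsSmoothedEFTest f p₀ p' p'' x₀) (hf00 : f 0 = 0) {s : ℂ}
    (hσ₁ : -(1 / 2) < s.re) (hσ₂ : s.re < 3 / 2)
    (hsz : ∀ ρ : ℂ, L ρ = 0 → 0 < ρ.re → ρ.re < 1 → ρ ≠ s) :
    NumberField.coefFordK (rcCoef 𝔪 ψ) f s =
      -(∑' ρ : nontrivialZeros L, (analyticOrderNatAt L (ρ : ℂ) : ℂ) * fordLaplace₀ f (s - ρ)) -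
        (analyticOrderNatAt L 0 : ℂ) * fordLaplace₀ f s + rcEFRemainder L f s := by
  have hc : L (2 + ((0 : ℝ) : ℂ) * I) ≠ 0 := continuation_two_ne_zero h𝔪 hψ hnt hL hLs 0
  have hsum := (summable_norm_rcZeroTerm hψ hprim hp h𝔪 hnt hL hLs hL' hL's h (by linarith) hsz).of_norm
  set S := ∑' ρ : nontrivialZeros L, (analyticOrderNatAt L (ρ : ℂ) : ℂ) * fordLaplace₀ f (s - ρ) with hS
  set m₀F : ℂ := (analyticOrderNatAt L 0 : ℂ) * fordLaplace₀ f s with hm₀F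
  set A' : ℝ := |(discr K : ℝ)| * (Ideal.absNorm 𝔪 : ℝ) with hA'
  set nK : ℕ := Module.finrank ℚ K with hnK
  have hA'1 : 1 ≤ A' := by
    have h1 : (1 : ℝ) ≤ |(discr K : ℝ)| := by
      have := Int.one_le_abs (discr_ne_zero K)
      rw [← Int.cast_abs]; exact_mod_cast this
    have h2 : (1 : ℝ) ≤ (Ideal.absNorm 𝔪 : ℝ) := by
      exact_mod_cast Nat.one_le_iff_ne_zero.mpr (by rwa [ne_eq, Ideal.absNorm_eq_zero_iff])
    rw [hA']; nlinarith
  have hlogA' : 0 ≤ Real.log A' := Real.log_nonneg hA'1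
  have hn0 : (0 : ℝ) ≤ nK := Nat.cast_nonneg _
  have hn1 : (1 : ℝ) ≤ nK := by rw [hnK]; exact_mod_cast Module.finrank_pos
  -- the scale `ℳ(T) = log A' + 3n + n log(|T| + 7)`
  have hℳ1 : ∀ T : ℝ, 1 ≤ Real.log A' + 3 * nK + nK * Real.log (|T| + 7) := fun T ↦ by
    have : 0 ≤ Real.log (|T| + 7) := Real.log_nonneg (by linarith [abs_nonneg T])
    nlinarith
  -- good heights `T N ∈ [N, N+1]`
  have hgh : ∀ N : ℕ, ∃ T : ℝ, (N : ℝ) ≤ T ∧ T ≤ N + 1 ∧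
      ∀ ρ : ℂ, L ρ = 0 → 0 < ρ.re → ρ.re < 1 →
        (1 / 514) / (Real.log A' + 3 * nK + nK * Real.log (|T| + 7)) ≤ |(|ρ.im|) - T| := by
    intro N
    obtain ⟨T, hT, hsepT⟩ := exists_goodHeight_continuation hψ hprim hp h𝔪 hnt hL hLs hL' hL's
      (τ₀ := N) (Nat.cast_nonneg N)
    exact ⟨T, hT.1, hT.2, hsepT⟩
  choose T hTN hTN1 hsep using hgh
  have hTtop : Tendsto T atTop atTop := tendsto_atTop_mono hTN tendsto_natCast_atTop_atTop
  set η : ℕ → ℝ := fun N ↦ min ((1 / 514) / (Real.log A' + 3 * nK + nK * Real.log (|T N| + 7))) 1 with hη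
  have hT0 : ∀ N, 0 ≤ T N := fun N ↦ (Nat.cast_nonneg N).trans (hTN N)
  have hη0 : ∀ N, 0 < η N := fun N ↦ lt_min (div_pos (by norm_num) (by linarith [hℳ1 (T N)])) one_pos
  have hη1 : ∀ N, η N ≤ 1 := fun N ↦ min_le_right _ _
  have hηsep : ∀ N, ∀ ρ : ℂ, L ρ = 0 → 0 < ρ.re → ρ.re < 1 → η N ≤ |ρ.im - T N| ∧ η N ≤ |ρ.im + T N| :=
    fun N ρ h0 h1 h2 ↦ ExplicitPsiChar.dist_of_abs_sub_le (hT0 N) ((min_le_left _ _).trans (hsep N ρ h0 h1 h2))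
  -- the same for `χ̄` at `−T N`, by the symmetry of the zeros
  have hηsep' : ∀ N, ∀ ρ : ℂ, L' ρ = 0 → 0 < ρ.re → ρ.re < 1 → η N ≤ |ρ.im - -T N| := by
    intro N ρ h0 h1 h2
    have hs : ∀ n : ℤ, 1 - ρ ≠ n := NumberField.one_sub_ne_int (NumberField.ne_int_of_mem_strip h1 h2)
    have h0' : L (1 - ρ) = 0 :=
      (continuation_eq_zero_iff hψ hprim hp h𝔪 hL hLs hL' hL's hs).2 (by rwa [sub_sub_cancel])
    have := (hηsep N (1 - ρ) h0' (by simp; linarith) (by simp; linarith)).1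
    simp only [sub_im, one_im, zero_sub] at this
    rwa [show -ρ.im - T N = -(ρ.im - -T N) by ring, abs_neg] at this
  obtain ⟨N₀, hN₀⟩ := exists_nat_gt (2 * |s.im| + 2)
  have hbig : ∀ N : ℕ, max N₀ 2 ≤ N → 2 ≤ N ∧ |s.im| + 1 < T N ∧ (N : ℝ) / 2 ≤ T N - |s.im| := by
    intro N hN
    have hN2 : 2 ≤ N := le_of_max_le_right hN
    have hNN₀ : (N₀ : ℝ) ≤ N := by exact_mod_cast le_of_max_le_left hN
    have hT := hTN N
    refine ⟨hN2, by linarith [abs_nonneg s.im], by linarith [abs_nonneg s.im]⟩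
  -- (1) the truncated zero sums
  have hpart : Tendsto (fun N : ℕ ↦ ∑ ρ ∈ zeroFinset hL hc (T N),
      (analyticOrderNatAt L (ρ : ℂ) : ℂ) * fordLaplace₀ f (s - ρ)) atTop (𝓝 S) :=
    (hsum.hasSum.comp (tendsto_zeroFinset hL hc)).comp hTtop
  -- (2) the horizontal sides
  set D := SmoothedEF.decayConst p' p'' x₀ with hD
  have hD0 : 0 ≤ D := SmoothedEF.decayConst_nonneg h.x₀_nonneg
  set B : ℝ := Real.log A' + 4 * nK + 1 with hB
  have hB1 : 1 ≤ B := by rw [hB]; linarith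
  set Mh : ℝ := 80000 * B * (515 * B) * (D * 4) * 2 * 4 with hMh
  have hhor0 : ∀ sgn : ℝ, (sgn = 1 ∨ sgn = -1) →
      Tendsto (fun N : ℕ ↦ ∫ σ : ℝ in (-(1 / 2) : ℝ)..(3 / 2), rcEFIntegrand L f s (σ + ((sgn * T N : ℝ) : ℂ) * I))
        atTop (𝓝 0) := by
    intro sgn hsgn
    refine squeeze_zero_norm' ?_ (by simpa using ((ZetaZeroSum.tendsto_log_sq_div.const_mul Mh)))
    filter_upwards [eventually_ge_atTop (max N₀ 2)] with N hN
    obtain ⟨hN2, hsN, hgapN⟩ := hbig N hN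
    have hN2' : (2 : ℝ) ≤ N := by exact_mod_cast hN2
    have hT2 : 2 ≤ T N := by linarith [hTN N]
    have hTpos : 0 < T N := by linarith
    have hTabs : |sgn * T N| = T N := by
      rcases hsgn with rfl | rfl <;> simp [abs_of_pos hTpos]
    -- separation hypotheses at `sgn * T N`
    have hsepN : ∀ ρ : ℂ, L ρ = 0 → 0 < ρ.re → ρ.re < 1 → η N ≤ |ρ.im - sgn * T N| := by
      intro ρ h0 h1 h2
      rcases hsgn with rfl | rfl
      · simpa using (hηsep N ρ h0 h1 h2).1
      · have := (hηsep N ρ h0 h1 h2).2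
        rwa [show ρ.im - -1 * T N = ρ.im + T N by ring]
    have hsepN' : ∀ ρ : ℂ, L' ρ = 0 → 0 < ρ.re → ρ.re < 1 → η N ≤ |ρ.im - -(sgn * T N)| := by
      intro ρ h0 h1 h2
      rcases hsgn with rfl | rfl
      · simpa using hηsep' N ρ h0 h1 h2
      · have hs' : ∀ n : ℤ, 1 - ρ ≠ n := NumberField.one_sub_ne_int (NumberField.ne_int_of_mem_strip h1 h2)
        have h0' : L (1 - ρ) = 0 :=
          (continuation_eq_zero_iff hψ hprim hp h𝔪 hL hLs hL' hL's hs').2 (by rwa [sub_sub_cancel])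
        have := (hηsep N (1 - ρ) h0' (by simp; linarith) (by simp; linarith)).2
        simp only [sub_im, one_im, zero_sub] at this
        rw [show -ρ.im + T N = -(ρ.im - -(-1 * T N)) by ring, abs_neg] at this
        exact this
    have hbd := norm_integral_rcIntegrand_horizontal_le hψ hprim hp h𝔪 hnt hL hLs hL' hL's h hσ₁
      (T := sgn * T N) (η := η N) (by rw [hTabs]; exact hT2) (by rw [hTabs]; linarith) (hη0 N) (hη1 N) hsepN hsepN'
    rw [hTabs] at hbd
    refine hbd.trans ?_
    -- bookkeeping
    set ℓ := Real.log ((N : ℝ) + 7) with hℓ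
    have hℓ1 : 1 ≤ ℓ := by
      rw [hℓ, Real.le_log_iff_exp_le (by positivity)]; linarith [Real.exp_one_lt_d9]
    have hlogT : Real.log (T N + 7) ≤ 2 * ℓ := by
      calc Real.log (T N + 7) ≤ Real.log (((N : ℝ) + 7) ^ 2) := by
            refine Real.log_le_log (by linarith) ?_; nlinarith [hTN1 N]
        _ = 2 * ℓ := by rw [Real.log_pow, hℓ]; norm_num
    have hlogT1 : 1 ≤ Real.log (T N + 7) := by
      rw [Real.le_log_iff_exp_le (by linarith)]; linarith [Real.exp_one_lt_d9]
    set ℳN : ℝ := Real.log A' + 3 * nK + nK * Real.log (T N + 7) with hℳN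
    have h2ℓ : 1 ≤ 2 * ℓ := by linarith
    have hDisc : ℳN ≤ B * (2 * ℓ) := by
      rw [hℳN, hB]
      nlinarith [mul_le_mul_of_nonneg_left hlogT hn0, mul_le_mul_of_nonneg_left h2ℓ hlogA',
        mul_le_mul_of_nonneg_left h2ℓ hn0]
    have hℳN1 : 1 ≤ ℳN := by
      have := hℳ1 (T N); rwa [abs_of_pos hTpos] at this
    have hηN : η N = min ((1 / 514) / ℳN) 1 := by
      have e7 : Real.log (|T N| + 7) = Real.log (T N + 7) := by rw [abs_of_pos hTpos]
      simp only [hη, hℳN, e7]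
    have h1η : 1 / η N ≤ 515 * B * (2 * ℓ) := by
      have hBl : 1 ≤ B * (2 * ℓ) := by nlinarith
      rw [hηN]
      rcases le_total ((1 / 514) / ℳN) 1 with hcase | hcase
      · rw [min_eq_left hcase, one_div_div]
        calc ℳN / (1 / 514) = 514 * ℳN := by ring
          _ ≤ 514 * (B * (2 * ℓ)) := by nlinarith [hDisc]
          _ ≤ 515 * B * (2 * ℓ) := by nlinarith
      · rw [min_eq_right hcase, div_one]; nlinarith
    have hN0 : (0 : ℝ) < N := by linarith
    have e1 : 80000 * ℳN / η N ≤ 80000 * B * (515 * B) * 4 * ℓ ^ 2 := by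
      have e0 : 80000 * ℳN / η N = 80000 * ℳN * (1 / η N) := by ring
      rw [e0]
      calc 80000 * ℳN * (1 / η N) ≤ 80000 * (B * (2 * ℓ)) * (515 * B * (2 * ℓ)) :=
            mul_le_mul (mul_le_mul_of_nonneg_left hDisc (by positivity)) h1η
              (by have := hη0 N; positivity) (by positivity)
        _ = 80000 * B * (515 * B) * 4 * ℓ ^ 2 := by ring
    have hsq' : (N : ℝ) / 4 ≤ (T N - |s.im|) ^ 2 := by
      have hsq : ((N : ℝ) / 2) ^ 2 ≤ (T N - |s.im|) ^ 2 := pow_le_pow_left₀ (by positivity) hgapN 2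
      nlinarith
    have e2 : D / (T N - |s.im|) ^ 2 ≤ D * 4 / N :=
      (div_le_div_of_nonneg_left hD0 (by positivity) hsq').trans_eq (by rw [div_div_eq_mul_div])
    calc 80000 * ℳN / η N * (D / (T N - |s.im|) ^ 2) * 2
        ≤ 80000 * B * (515 * B) * 4 * ℓ ^ 2 * (D * 4 / N) * 2 :=
          mul_le_mul_of_nonneg_right (mul_le_mul e1 e2 (by positivity) (by positivity)) (by norm_num)
      _ = Mh * (ℓ ^ 2 / N) := by rw [hMh]; ring
  -- (3) the vertical sides
  obtain ⟨hIright, hvalright⟩ := integral_rcIntegrand_right h𝔪 hψ hLs h hσ₂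
  have hright : Tendsto (fun N : ℕ ↦ ∫ y : ℝ in (-T N)..T N, rcEFIntegrand L f s (((3 / 2 : ℝ) : ℂ) + y * I)) atTop
      (𝓝 (2 * π * NumberField.coefFordK (rcCoef 𝔪 ψ) f s)) := by
    have h3 := intervalIntegral_tendsto_integral hIright (tendsto_neg_atTop_atBot.comp hTtop) hTtop
    rwa [hvalright] at h3
  have hleft : Tendsto (fun N : ℕ ↦ ∫ y : ℝ in (-T N)..T N, rcEFIntegrand L f s (((-(1 / 2) : ℝ) : ℂ) + y * I)) atTop
      (𝓝 (2 * π * rcEFRemainder L f s)) := by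
    have h3 := intervalIntegral_tendsto_integral
      (integrable_rcIntegrand_left hψ hprim hp h𝔪 hnt hL hLs hL' hL's h hf00 hσ₁)
      (tendsto_neg_atTop_atBot.comp hTtop) hTtop
    have hval : ∫ y : ℝ, rcEFIntegrand L f s (((-(1 / 2) : ℝ) : ℂ) + y * I) = 2 * π * rcEFRemainder L f s := by
      have hπ : (2 * π : ℂ) ≠ 0 := by simp [Real.pi_ne_zero]
      rw [rcEFRemainder, ← mul_assoc, mul_one_div_cancel hπ, one_mul]
    rwa [hval] at h3
  -- (4) the boundary integral along `T N` and its two limits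
  have hlim1 : Tendsto (fun N : ℕ ↦ rectBoundaryIntegral (rcEFIntegrand L f s) (-(1 / 2)) (3 / 2) (-T N) (T N)) atTop
      (𝓝 (0 - 0 + I * (2 * π * NumberField.coefFordK (rcCoef 𝔪 ψ) f s) - I * (2 * π * rcEFRemainder L f s))) := by
    have hb := hhor0 (-1) (Or.inr rfl)
    have ht := hhor0 1 (Or.inl rfl)
    simp only [neg_mul, one_mul] at hb ht
    have := ((hb.sub ht).add (hright.const_mul I)).sub (hleft.const_mul I)
    refine this.congr fun N ↦ ?_
    simp only [rectBoundaryIntegral]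
  have hgoodN : ∀ N, max N₀ 2 ≤ N → ∀ ρ : ℂ, L ρ = 0 → 0 < ρ.re → ρ.re < 1 → ρ.im ≠ T N ∧ ρ.im ≠ -T N := by
    intro N hN ρ h0 h1 h2
    obtain ⟨ha, hb⟩ := hηsep N ρ h0 h1 h2
    have hη0N := hη0 N
    refine ⟨fun he ↦ ?_, fun he ↦ ?_⟩
    · rw [he, sub_self, abs_zero] at ha; linarith
    · rw [he, neg_add_cancel, abs_zero] at hb; linarith
  have hid : ∀ᶠ N : ℕ in atTop,
      2 * π * I * (-(∑ ρ ∈ zeroFinset hL hc (T N), (analyticOrderNatAt L (ρ : ℂ) : ℂ) * fordLaplace₀ f (s - ρ)) - m₀F) =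
        rectBoundaryIntegral (rcEFIntegrand L f s) (-(1 / 2)) (3 / 2) (-T N) (T N) := by
    filter_upwards [eventually_ge_atTop (max N₀ 2)] with N hN
    obtain ⟨hN2, hsN, -⟩ := hbig N hN
    have hTpos : 0 < T N := by linarith [abs_nonneg s.im]
    rw [rcEF_contour_identity hψ hprim hp h𝔪 hnt hL hLs hL' hL's h.cont h.x₀_nonneg h.eq_zero hf00 s hTpos (hgoodN N hN),
      sum_rectZeros_continuation hψ hprim hp h𝔪 hnt hL hLs hL' hL's hTpos, ← sum_zeroFinset_eq hL hc (T N)]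
    congr 1
    rw [hm₀F, sub_zero]
    simp only [neg_mul, Finset.sum_neg_distrib]
    ring
  have hlim2 : Tendsto (fun N : ℕ ↦
      2 * π * I * (-(∑ ρ ∈ zeroFinset hL hc (T N), (analyticOrderNatAt L (ρ : ℂ) : ℂ) * fordLaplace₀ f (s - ρ)) - m₀F))
      atTop (𝓝 (2 * π * I * (-S - m₀F))) :=
    (hpart.neg.sub tendsto_const_nhds).const_mul _
  have heq := tendsto_nhds_unique hlim2 (hlim1.congr' (hid.mono fun N h ↦ h.symm))
  have hπ : (2 * π * I : ℂ) ≠ 0 := by simp [Real.pi_ne_zero]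
  have key : 2 * π * I * (NumberField.coefFordK (rcCoef 𝔪 ψ) f s - rcEFRemainder L f s) = 2 * π * I * (-S - m₀F) := by
    rw [heq]; ring
  have := mul_left_cancel₀ hπ key
  rw [hm₀F] at this
  linear_combination this

end Literature.NumberTheory.LFunctions
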